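import Summits.HodgeConjecture.HodgeConjecture.Cruxes.BlochSeedDiscOne.Anchor
import Summits.Ventures.HSemireg.TwoLevelObstructionBridge
import Summits.Ventures.HSemireg.MarkmanClassStatementTower
import Summits.Ventures.HSemireg.AmplificationChainG4RouteC
import Summits.Ventures.HSemireg.AmplificationChainSigmaGluable
import Literature.AlgebraicGeometry.HodgeTheory.SemiregularityHigherSigma
import HarnessLib

/-!
# LINE «torus-carrier sheaf door» for crux H2 = stmt-HodgeConjecture-18881 `EightfoldBlochSeeds.BlochSeedDiscOne`
(plan-lens-HodgeAV-transfer g0, lens = transfer; sibling = SHEAF semiregularity, Buchweitz–Flenner 2003 / Bloch 1972).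

(IMPORT HYGIENE, idea-crit-6 L2 price T4: this file imports the sorry-free `Cruxes/BlochSeedDiscOne/Anchor.lean`, NOT the sorried skeleton
`Lines/birth.lean`, so no `C → BlochSeedDiscOne` probe can close through `Birth.BlochSeedDiscOne_of_pad4`.)

STATUS v2 (2026-08-28, falsifier F2 run by pencil — memo `Cruxes/BlochSeedDiscOne/TorusCarrierTraceNoGo.md`): ε-TRACE NO-GO —
no iterated extension of structure sheaves of PRODUCT elliptic-curve sub-tori of `S⁴` with `ch ∈ W` is `I`-semiregular for any `I`
(B–F Cor. 4.3 puts `ob_κ(F)` in `⋂ ker σ_q` for the 32 Weil directions; a partial-trace identity shows `ob_κ(F) ≠ 0` for a mixing `κ`).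
Hence the INTENDED witness class of `TorusCarrierSheafSeedPad4` (excess-glued torus complexes) is dead; the Prop itself (any gluable-σ
perfect complex on the anchor) is untouched and keeps the compositions below; the repaired construction problem (cross-factor sub-tori,
first-order TRACE CRITERION) is K3 of the card. Nothing here changes for `BlochSeedDiscOne`.

STATUS v4 (2026-08-28, g3, gate F4b-LOCAL by pencil — memo §7e): DIRECT-SUM NO-GO = LEMMA VI (Part D below, hypothesis form,
kernel-checked logic): a design complex that SPLITS as `F₁ ⊕ F₂` (no `Ext¹` between the parts) with flat TOTAL class but NON-flat
`ch₄(F₁)` carries, for one of the 16 polarised Weil directions `κ⁺`, a non-zero `ob_κ(F) ∈ ⋂_q ker σ_q`; so it is first-order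
OBSTRUCTED along `κ⁺` and not `I`-semiregular for any `I`.  Corollary (memo §7e (E.2)): the F4a design `D_mono` (bi-graphs ⊔ 70
coordinate tori, (T_a)-decoupled) is dead at F4b for EVERY gluing datum — torus padding must be `Ext¹`-LINKED.  Nothing here changes
for `BlochSeedDiscOne`.

STATUS v5 (2026-08-28, g4, gates N1-c / N1′ — memo §7i): THEOREM VII-u (Part E below: its linear-algebra core, kernel-checked;
model inputs S5/S9/S10 displayed): in every bi-graph block type `{m₁,m₂;s}` with CONNECTED edge intersections (G = 1) and `|c| ≠ 1`,
(d1) ∧ (d3) has no solution for any multiplicity assignment and any gluing (vertex identities ⇒ scalar diagonal blocks ⇒ spectral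
matching ⇒ starvation, using that the gluing is common to all Weil directions κ); `|c| = 1` is undecided at this level, and blocks
with G > 1 (the live design `D_RG`) are NOT covered (memo §7i (I.6) R1).  Nothing here changes for `BlochSeedDiscOne`.

STATUS v6 (2026-08-29, g7; THEOREM XV of g6, gate P39 / GATE LINE g6 priced PASS by idea-crit-6 g10, XV-u ×2 by idea-crit-hsem-2
memo-07 / director R19.172): Part F below is the LINEAR-ALGEBRA CORE of the rank-free T₄ kill — class pins make the two pinned vertex
operators non-zero scalars, the cycle-trace WORD IDENTITY gives `tr(O_X O_S) = 0`, hence the pinned multiplicity space is `0` for ANY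
dimension vector.  The type-dependent inputs (pins (V), quadruple-point lemma, weight identity) stay DISPLAYED binders: they are exact
integer certificates + pencil in memo §7m–§7n (`sec7m-cycletrace.md`, `sec7n-xvu.md`), not kernel facts.  Level words unchanged:
«template CLOSED at F4b for the block type, modulo S9–S13» — never «no-go proved».  Nothing here changes for `BlochSeedDiscOne`.

HONEST LABEL. HC / HC_CM / HC_AV are NOT proved; HC_CM is HELD (research route conditional on HC_CM, which enters only
as a displayed binder elsewhere; it is not used here); nothing below is a corollary of HC_CM.  This file proves only
(i) two dictionary lemmas MOD FRAME (Part A) and (ii) the tree composition from a NEW seed statement to the rung-H2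
leaf (Part B).  The seed statement `TorusCarrierSheafSeedPad4` is OPEN; it does NOT imply `BlochSeedDiscOne` as typed
(lci Bloch seed) — it reaches the same leaf `SevenfoldWeilCensus.WeilSixfolds` through the tree's perfect-complex door
(`perfectObjClass C gluableSigmaAdmissible`, Pridham 2024 Cor. 2.25 + algebraisation = `PerfectComplexVariationalHodge`,
an ASSUMPTION of printed strength in the tree) in place of Bloch (7.4).

## Part A — the B–F dictionary on the pad-4 first-order model (transfer of (c9) `SemiregularityDictionary` to SHEAF language)
For a Künneth–Leray frame `F` of a model design `D` (TwoLevelObstructionBridge, (c6)) with `E` finite locally free, the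
single dictionary hypothesis `BFHodgeDirections F hE I` says: for every direction `κ ∈ T_W` and every `q ∈ I`,
`σ_q(ob_κ(E)) = 0`.  In print this is [BuchweitzFlenner2003, Cor. 4.3] (`σ_q ∘ ⟨κ, −At(E)⟩ = ⟨κ, ch_{q+1}(E)⟩`, arXiv text
p. 20) composed with the CLASS CONDITION of the census designs (`ch(E) ∈ ℚ[h] ⊕ W`, and `h`, `W` stay Hodge along the Weil
family `T_W`, so `⟨κ, ch_{q+1}(E)⟩^{q,q+2} = 0`).  THEN: `IsISemiregular hE I → D.H2 F.sections` and, against THEOREM L^ζ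
(`theoremLZeta_holds`), class Y + minimal + (H1) ⟹ `¬ IsISemiregular hE I` for EVERY `I` — door D2 (B–F sheaf door on the
design bundle itself) is closed on class Y, and the class-Y obstruction IS, in B–F language, a non-zero element of
`(KS-image of T_W) ∩ ⋂_{q∈I} ker σ_q ⊂ Ext²(E,E)` (`exists_obExt_ne_zero_mem_ker_sigma`).  No LEMMA Z|E, no INJ_E, no Serre
duality is needed on the sheaf side (contrast (c9), which needs them to reach Bloch's `H¹(N_Z)`).
Census rows this explains (bc5-plan g8 card): j305149 r1 (H₁ = RULE-D+{X+,A2I−}), r2 (odd_fc UNSAT, H_odd = H₁), r3 (◇₈ full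
UNSAT 2362 s; minus-FC1 UNSAT); LINE 4 ⟨Δ²⟩×S₄ ◇₈ full18 UNSAT ×2 (j310053); gs2/g53 j309715 DRAT VERIFIED + peel j309861.

## Part B — E₀⁴-type TORUS CARRIERS and the first non-transferring step (pencil, this seat; details in the idea card)
Carriers `Z_λ = ∏_{f≤4} C_{λ_f} ⊂ P = S⁴`, `C_λ = ker(z_A + λ z_B) ⊂ S = E₀²`, `λ_f ∈ ℤ[i]`: abelian sub-fourfolds ≅ E₀⁴ with an
exact product complement `Z' = ∏ C_∞`, `P = Z_λ × Z'`.  (T1) signed designs `Σ ε_a [Z_a] = w ∈ W ∖ 0` exist; (T2) every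
`i_*𝒪_{Z_λ} = 𝒪_Z ⊠ k(0)` is B–F semiregular (Künneth: `Ext²_P = ⊕_{a+b=2} H^a(𝒪_Z) ⊗ ∧^b T₀Z'`, `σ_{4−b}(y ⊗ η) = y ⊠ ι_η vol`
injective); (T3) pairwise TRANSVERSE carriers have `Ext^j(𝒪_{Z_a}, 𝒪_{Z_b}) = 0` for `j ≠ 4`, so split and point-glued
complexes have `Ext²(F,F) = ⊕_a Ext²(𝒪_{Z_a}, 𝒪_{Z_a})`, `σ_F = Σ ± σ_a` (tree: HomComplexSigmaDinatural biproduct lemmas);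
(T4) ε-SYZYGY NO-GO: the `b = 1` images decompose over Künneth blocks `(T′, g)` of `H^{3,5}(P)`; in the block
`(T′, g) = ({1,2,3}, 4)` the generator of carrier `a` has the 64 monomial coordinates `∏_{f∈A} λ_{a,f} ∏_{f∈B} λ̄_{a,f}`
(`A ⊆ T′`, `B ⊆ {1,2,3}`), all of which are NON-`W` Künneth coefficients of `[Z_a]`; hence `W`-purity of `Σ ε_a [Z_a]` forces
`Σ_a ε_a e_a(T′,g) = 0`, i.e. a non-zero element of `⋂_q ker σ_q` on every split / point-glued torus-carrier complex:
NONE of them is `gluableSigmaAdmissible`.  «The class condition itself is the obstruction» — the sheaf-door twin of Part A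
and of the census UNSATs.  FIRST NON-TRANSFERRING STEP = CRUX K1: EXCESS-GLUED torus complexes (carriers sharing ≥ 2 factor
curves, glued by `δ ∈ Ext²(𝒪_{Z_b}, 𝒪_{Z_a})`, shift −1 — the only sign-producing gluing), where `d₁(x_ε) = [δ, x_ε] ∈
⊕ Ext³` can kill the syzygy.  Typed target: `TorusCarrierSheafSeedPad4 C` below (member form on the named pad-4 anchor,
mirroring STUB R of `Lines/birth.lean` with the Bloch seed replaced by a gluable-σ perfect-complex seed).
-/

namespace Summit.HodgeConjecture.HodgeConjecture.Cruxes.BlochSeedDiscOne.TorusSheafDoor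

open CategoryTheory CategoryTheory.Limits AlgebraicGeometry
open Literature.AlgebraicGeometry Literature.AlgebraicGeometry.Motives Literature.AlgebraicGeometry.HodgeTheory
open Literature.AlgebraicGeometry.Modules
open Summit.Ventures.HSemireg Summit.Ventures.HSemireg.TwoLevelObstruction Summit.Ventures.HSemireg.Pad4FirstOrder
open Summit.HodgeConjecture.HodgeConjecture.Cruxes.BlochSeedDiscOne.Anchor
open Summit.HodgeConjecture.HodgeConjecture.WeilTypeLadder
open Summit.HodgeConjecture.HodgeConjecture.Cruxes.HodgeAbelianVarieties.EStepSecantInduction (WeilAlgebraicAll)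

set_option linter.dupNamespace false

universe w u

/-! ## Part A — the B–F dictionary MOD FRAME -/

section PartA

variable {k : Type u} [CommRing k] {X : Over (Spec (CommRingCat.of k))} [HasExt.{w} X.left.Modules]
  [HasFiniteBiproducts X.left.Modules] {D : Design} {h2 : 1 + 1 = 2} (F : KunnethLerayFrame X D h2)
  (hE : IsFiniteLocallyFree F.E) (I : Set ℕ)

/-- **The B–F dictionary hypothesis of a frame** (the SHEAF twin of (c9)'s `bloch_hodge`): for every direction
`κ ∈ T_W ≅ M₄(ℂ)` and every form degree `q ∈ I`, the higher semiregularity component kills the obstruction class,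
`σ_q(ob_κ(E)) = 0`.  In print: `σ_q(⟨κ, −At E⟩) = ⟨κ, ch_{q+1}(E)⟩` [BuchweitzFlenner2003, Cor. 4.3] and the class
condition `ch(E) ∈ ℚ[h] ⊕ W` of the census designs (those classes stay Hodge along `T_W`).  A HYPOTHESIS (Prop),
nothing asserted. [cite: BuchweitzFlenner2003, Cor. 4.3 and Def. 4.1] [cite: Bloch1972Semiregularity, (4.1)–(4.3)] -/
def BFHodgeDirections : Prop :=
  ∀ (κ : Matrix (Fin 4) (Fin 4) ℂ), ∀ q ∈ I, sigmaHigher hE q (obExt (F.hκ κ) h2 F.E) = 0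

variable {F hE I}

/-- **Sheaf door ⟹ (H2), MOD FRAME + DICTIONARY**: if the design object `E` is `I`-semiregular in the sense of
Buchweitz–Flenner (`(σ_q)_{q∈I}` jointly injective on `Ext²(E,E)`), then every `ob_κ(E)` vanishes, hence row 716's `(H2)`
holds at the frame's sections (`KunnethLerayFrame.H2_of_forall_obExt_eq_zero`). [cite: BuchweitzFlenner2003, Cor. 4.3, §5] -/
theorem H2_of_isISemiregular (hΦ : BFHodgeDirections F hE I) (hσ : IsISemiregular hE I) : D.H2 F.sections :=
  F.H2_of_forall_obExt_eq_zero fun κ => hσ _ (hΦ κ)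

/-- **Door D2 is closed on class Y (the census words in B–F language)**: a class-Y model design with a frame whose
sections are a minimal presentation and `(H1)` (`μ ≠ 0`) is NOT `I`-semiregular, for ANY set of degrees `I` — THEOREM L^ζ
(`theoremLZeta_holds`) through `KunnethLerayFrame.not_forall_obExt_eq_zero`.  [cite: BuchweitzFlenner2003, Cor. 4.3, §5] -/
theorem not_isISemiregular_of_classY (hΦ : BFHodgeDirections F hE I) (hY : D.InClassY) (hmin : D.Minimal F.sections)
    (h1 : D.H1) : ¬ IsISemiregular hE I := fun hσ =>
  F.not_forall_obExt_eq_zero hY hmin h1 fun κ => hσ _ (hΦ κ)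

/-- **The class-Y obstruction LOCATED in B–F language**: under the dictionary, class Y + minimal + (H1) produce a direction
`κ ∈ T_W` whose Kodaira–Spencer obstruction `ob_κ(E) ∈ Ext²(E,E)` is NON-ZERO and lies in `⋂_{q∈I} ker σ_q` — an explicit
witness of non-injectivity of the semiregularity map of the design object. [cite: BuchweitzFlenner2003, Cor. 4.3] -/
theorem exists_obExt_ne_zero_mem_ker_sigma (hΦ : BFHodgeDirections F hE I) (hY : D.InClassY)
    (hmin : D.Minimal F.sections) (h1 : D.H1) :
    ∃ κ : Matrix (Fin 4) (Fin 4) ℂ, obExt (F.hκ κ) h2 F.E ≠ 0 ∧ ∀ q ∈ I, sigmaHigher hE q (obExt (F.hκ κ) h2 F.E) = 0 := by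
  obtain ⟨κ, hκ⟩ := F.exists_obExt_ne_zero hY hmin h1
  exact ⟨κ, hκ, hΦ κ⟩

end PartA

/-! ## Part B — the seed statement on torus carriers and its tree composition to the rung-H2 leaf -/

section PartB

variable (C : ChernCharacterBetti)

/-- **CRUX K1 (typed target of the line; OPEN; intended witnesses = EXCESS-GLUED complexes of structure sheaves of
E₀⁴-type product sub-tori of `S⁴`)**: on the named pad-4 anchor `S⁴(E₀)` of every CM curve `(E₀, ψ₀)`, `ψ₀² = −1`, there are
a projective embedding `e`, a rational hyperplane class `a ≠ 0` with `(pad4Anchor, pad4Action)` HYPERBOLIC for `h_K(e,a)`, a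
non-zero rational class `w` of the `ℚ(i)`-Weil plane, and a seed of the GLUABLE σ-CLASS of perfect complexes
(`perfectObjClass C gluableSigmaAdmissible`: a bounded complex of vector bundles with `Ext^{<0} = 0`, `{1..8} ⊆ I`,
`(σ_q)_{q+1∈I}` jointly injective, `ch_4 = q·h_K⁴ + w`, `ch_p = c_p h_Kᵖ` off 4).  Verbatim STUB R of `Lines/birth.lean`
with `HasBlochSeedAt` replaced by `HasSeedOn (perfectObjClass C gluableSigmaAdmissible)`.  NOT implied by and NOT implying
`BlochSeedDiscOne`; split / point-glued torus designs are EXCLUDED by the ε-syzygy no-go (module docstring (T4)).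
[cite: BuchweitzFlenner2003, Def. 4.1, §5] [cite: Pridham2024Semiregularity, Cor. 2.25] [cite: Bloch1972Semiregularity, Remark (7.5)] -/
def TorusCarrierSheafSeedPad4 : Prop :=
  ∀ (E₀ : AbelianVariety ℂ) (ψ₀ : E₀ ⟶ E₀), E₀.dim = 1 → ψ₀ ≫ ψ₀ = -(1 • 𝟙 E₀) →
    ∃ (e : ProjectiveEmbedding (pad4Anchor E₀).X) (a : complexBetti (projectiveSpace e.n ℂ) 2)
      (w : complexBetti (pad4Anchor E₀).X (2 * 4)),
      IsRationalClass a ∧ a ≠ 0 ∧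
      IsHyperbolicWeilType (pad4Anchor E₀) (pad4Action E₀ ψ₀) 4 (symH (pad4Action E₀ ψ₀) e a) ∧
      w ∈ weilClassesOf (pad4Anchor E₀) (pad4Action E₀ ψ₀) 4 1 ∧ IsRationalClass w ∧ w ≠ 0 ∧
      HasSeedOn (perfectObjClass C gluableSigmaAdmissible) 4 (pad4Anchor E₀) (symH (pad4Action E₀ ψ₀) e a) w

variable {C}

/-- K1 ⟹ the existential hyperbolic seed of the gluable σ-class at level 4 for `K = ℚ(i)` (anchor bookkeeping of
`Lines/birth.lean`: `exists_cmCurve_sqrt_neg 1`, `pad4Anchor_dim`, `pad4Action_comp_self`). [cite: vanGeemen1994HodgeAV, 5.2–5.4] -/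
theorem hasHyperbolicSeedOn_four_one_of_torusCarrierSheafSeedPad4 (hS : TorusCarrierSheafSeedPad4 C) :
    HasHyperbolicSeedOn (perfectObjClass C gluableSigmaAdmissible) 4 1 := by
  obtain ⟨E₀, ψ₀, hE, hψ⟩ :=
    Literature.NumberTheory.EllipticCurves.CMEndomorphism.exists_cmCurve_sqrt_neg 1 one_pos
  obtain ⟨e, a, w, ha, ha0, hhyp, hwW, hwr, hw0, hseed⟩ := hS E₀ ψ₀ hE hψ
  exact ⟨pad4Anchor E₀, pad4Action E₀ ψ₀, e, a, w, pad4Anchor_dim hE, pad4Action_comp_self hψ, ha, ha0, hhyp,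
    hwW, hwr, hw0, hseed⟩

/-- **FIRST LEMMA of the line (PROVED tree composition)**: Deligne's hyperbolic reach + the perfect-complex door
(`PerfectComplexVariationalHodge C gluableSigmaAdmissible`, Pridham 2024 Cor. 2.25 + algebraisation; ASSUMPTION of printed
strength) + K1 ⟹ the Hodge–Weil classes of EVERY `ℚ(i)`-Weil abelian sixfold (`WeilAlgebraicAll 3 1`, all cells `δ`).
[cite: Pridham2024Semiregularity, Cor. 2.25] [cite: Deligne1982HodgeCycles, proof of Thm. 4.8] [cite: Schoen1998HodgeWeilAddendum, §10] -/
theorem weilAlgebraicAll_three_one_of_torusCarrierSheafSeed (hF : weilFamilyReach_hyperbolic)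
    (hT : PerfectComplexVariationalHodge C gluableSigmaAdmissible) (hS : TorusCarrierSheafSeedPad4 C) :
    WeilAlgebraicAll 3 1 :=
  weilAlgebraicAll_three_of_reach_of_localVariationalHodgeFor_of_hyperbolicSeedOn_four hF hT.localVariationalHodgeFor
    one_pos (hasHyperbolicSeedOn_four_one_of_torusCarrierSheafSeedPad4 hS)

/-- **RUNG-LEVEL COMPOSITION (PROVED)**: route EightfoldBlochSeeds' `closes` with the binder `BlochSeedDiscOne` (18881)
REPLACED by K1 + the perfect-complex door — mixed doors per `d` through `weilSixfolds_of_reach_of_localAnchor_four`: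
`d = 1` by the gluable σ-class, `d = 3` and generic `d` by Bloch seeds + Bloch (7.4).  Conclusion = the rung-H2 leaf
`SevenfoldWeilCensus.WeilSixfolds`. [cite: Markman2025SecantWeil, §1.2 (preprint)] [cite: Schoen1998HodgeWeilAddendum, §10] -/
theorem weilSixfolds_of_mixedDoors (h₂ : Theses.EightfoldBlochSeeds.BlochSeedsGeneric) (hS : TorusCarrierSheafSeedPad4 C)
    (h₄ : Theses.EightfoldBlochSeeds.BlochSeedDiscThree) (hF : Theses.EightfoldBlochSeeds.ReachHyperbolic)
    (hB : Theses.EightfoldBlochSeeds.BlochSpreadEightFour) (hT : PerfectComplexVariationalHodge C gluableSigmaAdmissible) :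
    Theses.SevenfoldWeilCensus.WeilSixfolds :=
  weilSixfolds_of_reach_of_localAnchor_four hF fun d hd => by
    by_cases h1 : d = 1
    · subst h1
      exact hasLocallyAlgebraicWeilAnchor_of_localVariationalHodgeFor_of_hyperbolicSeedOn hT.localVariationalHodgeFor
        (hasHyperbolicSeedOn_four_one_of_torusCarrierSheafSeedPad4 hS)
    by_cases h3 : d = 3
    · subst h3
      exact hasLocallyAlgebraicWeilAnchor_of_blochSpread_of_hyperbolicBlochSeed hB h₄
    · exact hasLocallyAlgebraicWeilAnchor_of_blochSpread_of_hyperbolicBlochSeed hB (h₂ d hd h1 h3)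

/-! ### Registration shapes asked for by the critic of record (idea-crit-6 g3, LENS RULING L2, prices T1 / T2) -/

/-- **K1, `∀ C` form (price T1: register as `∀ C : ChernCharacterBetti, …`, never `∃ C`).**  The Chern-character theory is a
normalised parameter structure shared with the door; the universally quantified form is the registration shape when K1 is filed
on its own (the `C`-shared closes-shaped statements below are the other admissible shape). -/
def TorusCarrierSheafSeedPad4All : Prop := ∀ C : ChernCharacterBetti, TorusCarrierSheafSeedPad4 C

theorem torusCarrierSheafSeedPad4_of_all (h : TorusCarrierSheafSeedPad4All) (C : ChernCharacterBetti) :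
    TorusCarrierSheafSeedPad4 C := h C

/-- **FIRST LEMMA on the SPLIT trust base (price T2)**: the perfect-complex door replaced BY NAME by the PAIR
`PridhamPerfectLifts C` (the PRINTED, page-cited statement: [Pridham2024Semiregularity] Cor. 2.25 + Rem. 2.27 + Rem. 2.21 +
Lemma 1.8–1.9, typed venture-side on the real `σ`-carrier) and `PerfectComplexAlgebraisesLifts C` (the ALGEBRAISATION clause,
Hodge-free, its own displayed binder; [Perry2022] proof of Prop. 8.1 shape, [Lieblich2006] Thm. 4.2.1) — composed through the tree's
`localVariationalHodgeFor_gluable_of_pridhamPerfect_of_algebraisesLifts`.  HC / HC_AV NOT proved; both binders are assumptions. -/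
theorem weilAlgebraicAll_three_one_of_torusCarrierSheafSeed_split (hF : weilFamilyReach_hyperbolic)
    (hP : PridhamPerfectLifts C) (hA : PerfectComplexAlgebraisesLifts C) (hS : TorusCarrierSheafSeedPad4 C) :
    WeilAlgebraicAll 3 1 :=
  weilAlgebraicAll_three_of_reach_of_localVariationalHodgeFor_of_hyperbolicSeedOn_four hF
    (localVariationalHodgeFor_gluable_of_pridhamPerfect_of_algebraisesLifts hP hA)
    one_pos (hasHyperbolicSeedOn_four_one_of_torusCarrierSheafSeedPad4 hS)

/-- **RUNG-LEVEL COMPOSITION on the SPLIT trust base (price T2)**: `weilSixfolds_of_mixedDoors` with the door binder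
`PerfectComplexVariationalHodge C gluableSigmaAdmissible` replaced by the pair (`PridhamPerfectLifts C`,
`PerfectComplexAlgebraisesLifts C`), `C` shared with K1 in one closes-shaped statement (price T1, second admissible shape). -/
theorem weilSixfolds_of_mixedDoors_split (h₂ : Theses.EightfoldBlochSeeds.BlochSeedsGeneric) (hS : TorusCarrierSheafSeedPad4 C)
    (h₄ : Theses.EightfoldBlochSeeds.BlochSeedDiscThree) (hF : Theses.EightfoldBlochSeeds.ReachHyperbolic)
    (hB : Theses.EightfoldBlochSeeds.BlochSpreadEightFour) (hP : PridhamPerfectLifts C)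
    (hA : PerfectComplexAlgebraisesLifts C) : Theses.SevenfoldWeilCensus.WeilSixfolds :=
  weilSixfolds_of_reach_of_localAnchor_four hF fun d hd => by
    by_cases h1 : d = 1
    · subst h1
      exact hasLocallyAlgebraicWeilAnchor_of_localVariationalHodgeFor_of_hyperbolicSeedOn
        (localVariationalHodgeFor_gluable_of_pridhamPerfect_of_algebraisesLifts hP hA)
        (hasHyperbolicSeedOn_four_one_of_torusCarrierSheafSeedPad4 hS)
    by_cases h3 : d = 3
    · subst h3
      exact hasLocallyAlgebraicWeilAnchor_of_blochSpread_of_hyperbolicBlochSeed hB h₄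
    · exact hasLocallyAlgebraicWeilAnchor_of_blochSpread_of_hyperbolicBlochSeed hB (h₂ d hd h1 h3)

/-- The `∀ C` registration shape feeds the rung through ANY one theory `C` for which the split door is granted. -/
theorem weilSixfolds_of_mixedDoors_all (h₂ : Theses.EightfoldBlochSeeds.BlochSeedsGeneric) (hS : TorusCarrierSheafSeedPad4All)
    (h₄ : Theses.EightfoldBlochSeeds.BlochSeedDiscThree) (hF : Theses.EightfoldBlochSeeds.ReachHyperbolic)
    (hB : Theses.EightfoldBlochSeeds.BlochSpreadEightFour) (C : ChernCharacterBetti) (hP : PridhamPerfectLifts C)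
    (hA : PerfectComplexAlgebraisesLifts C) : Theses.SevenfoldWeilCensus.WeilSixfolds :=
  weilSixfolds_of_mixedDoors_split h₂ (hS C) h₄ hF hB hP hA

end PartB

/-! ## Part C — the ε-TRACE NO-GO in HYPOTHESIS FORM (idea-crit-6 L2′ (d); memo `Cruxes/BlochSeedDiscOne/TorusCarrierTraceNoGo.md`)

Theorem §5 of the memo, with its three non-tree inputs as DISPLAYED BINDERS and the partial-trace argument kernel-checked.  For a
strictly perfect complex `K•` (the realisation of an iterated extension `F` of torus-carrier sheaves with `ch F ∈ W`), ONE carrier `a`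
and ONE mixing Weil direction `κ` hitting it (memo §2.2), the inputs are:
* a twisted-complex MODEL of `RHom(F,F)` in degrees 1, 2: additive groups `C₁ →ᴰ C₂`, a comparison `cls : C₂ → Ext²(K•,K•)` exact at
  degree 2 (`cls z = 0 → z ∈ im D`) — INPUT «Künneth dg-equivalence for `⊠`» (memo §3/§8 S1), together with
* `kunneth_single_factor_path : ∀ y, trA (D y) ∈ Dg` — the SINGLE-FACTOR-PATH LEMMA (memo §4: INPUT «strictly unital minimal models and the
  associahedral tensor product», plus traceless self-commutators), where `trA` is the partial trace of the `(a,a)` carrier block onto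
  `V_a = H^{0,1}(Z_a) ⊗ N_a` and `Dg ⊂ V_a` the span of the single-factor classes `ȳ_{f₀} ⊗ n_{f₀}`;
* `filtered_atiyah : trA Lκ = 0` (memo §8 S2: jets are exact, `At(F)` is filtered, the correction `Lκ` is strictly lower, hence traceless)
  and `mixing_coordinate : trA Xκ = u • e`, `u ≠ 0`, `e ∉ Dg` (memo §2.2: `ob_κ(𝒪_{Z_a}) ⊗ id_{U_a}`, `e = ȳ_g ⊗ n_{f'}`, `g ≠ f'`,
  `u = u_a β_{f'} β̄_g`);
* `bf_cor_4_3 : ∀ q, σ_q (cls (Xκ + Lκ)) = 0` — INPUT «[BF03] Cor. 4.3 for perfect complexes»: `σ_q(ob_κ F) = κ ⌟ ch_{q+1}(F)`, which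
  vanishes because `κ` is a Weil direction (`κ ∈ ker ⌟w`) and `ch F` is concentrated in degree 4.
CONCLUSION (kernel): `K•` is not `J`-semiregular for ANY `J` (`HomComplex.IsISemiregularC`, the door's own predicate), hence never
`gluableSigmaAdmissible`.  Nothing is asserted about any concrete complex: supplying the binders for an actual torus design is exactly
the content of the memo (and of card item K2).  HC / HC_CM / HC_AV untouched. -/

section PartC

/-- **Abstract partial-trace lemma** (pure algebra; the logical core of memo §5): if the degree-2 cochain `X + L` were a boundary `D y`,
its partial trace would lie in the single-factor span `Dg` (`trA (D y) ∈ Dg`, `trA L = 0`), but `trA X = u • e` with `u ≠ 0`, `e ∉ Dg`.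
Hence the class `cls (X + L)` is non-zero. [folklore] -/
theorem cls_ne_zero_of_partialTrace {C₁ C₂ M : Type*} [AddCommGroup C₁] [AddCommGroup C₂] [AddCommGroup M]
    {𝕜 V : Type*} [Field 𝕜] [AddCommGroup V] [Module 𝕜 V]
    (D : C₁ →+ C₂) (cls : C₂ →+ M) (model_exact : ∀ z, cls z = 0 → ∃ y, D y = z)
    (trA : C₂ →+ V) (Dg : Submodule 𝕜 V) (single_factor : ∀ y, trA (D y) ∈ Dg)
    {X L : C₂} (hL : trA L = 0) {u : 𝕜} {e : V} (hX : trA X = u • e) (hu : u ≠ 0) (he : e ∉ Dg) :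
    cls (X + L) ≠ 0 := by
  intro h0
  obtain ⟨y, hy⟩ := model_exact _ h0
  have hmem : u • e ∈ Dg := by
    have h := single_factor y
    rwa [hy, map_add, hX, hL, add_zero] at h
  have : e ∈ Dg := by
    have h' := Dg.smul_mem u⁻¹ hmem
    rwa [smul_smul, inv_mul_cancel₀ hu, one_smul] at h'
  exact he this

universe w₁

variable (X₀ : SchemeOver ℂ) [HasDerivedCategory.{w₁} X₀.left.Modules] (K : CochainComplex X₀.left.Modules ℤ)

/-- **ε-TRACE NO-GO, hypothesis form** (memo Theorem §5; inputs displayed, see the Part C header for which binder is which input and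
which soft spot): the obstruction class `ob_κ(F) = cls (Xκ + Lκ) ∈ Ext²(K•, K•)` is NON-ZERO (partial-trace lemma) and lies in the joint
kernel of every `σ_q` ([BF03] Cor. 4.3 binder), so `K•` is not `J`-semiregular for any set `J` of form degrees.
[cite: BuchweitzFlenner2003, Cor. 4.3, Def. 4.1 and §5 (I-semiregular)] -/
theorem not_isISemiregularC_of_epsTraceInputs (a b : ℤ) [K.IsStrictlyGE a] [K.IsStrictlyLE b]
    (hK : ∀ p, IsFiniteLocallyFree (K.X p))
    {C₁ C₂ : Type*} [AddCommGroup C₁] [AddCommGroup C₂] (D : C₁ →+ C₂)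
    (cls : C₂ →+ ShiftedHom (DerivedCategory.Q.obj K) (DerivedCategory.Q.obj K) (2 : ℤ))
    (model_exact : ∀ z, cls z = 0 → ∃ y, D y = z)
    {V : Type*} [AddCommGroup V] [Module ℂ V] (trA : C₂ →+ V) (Dg : Submodule ℂ V)
    (kunneth_single_factor_path : ∀ y, trA (D y) ∈ Dg)
    (Xκ Lκ : C₂) (filtered_atiyah : trA Lκ = 0)
    {u : ℂ} {e : V} (mixing_coordinate : trA Xκ = u • e) (hu : u ≠ 0) (he : e ∉ Dg)
    (bf_cor_4_3 : ∀ q : ℕ, Summit.Ventures.HSemireg.HomComplex.sigmaC X₀ K a b hK q (cls (Xκ + Lκ)) = 0)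
    (J : Set ℕ) : ¬ Summit.Ventures.HSemireg.HomComplex.IsISemiregularC X₀ K a b hK J := by
  intro hJ
  have hne := cls_ne_zero_of_partialTrace D cls model_exact trA Dg kunneth_single_factor_path filtered_atiyah
    mixing_coordinate hu he
  exact hne ((Summit.Ventures.HSemireg.HomComplex.isISemiregularC_iff_ker X₀ K a b hK J).1 hJ _ fun q _ => bf_cor_4_3 q)

end PartC

section PartCDoor

variable {n : ℕ} {X₀ : SchemeOver ℂ} {I : Finset ℕ} {K : CochainComplex X₀.left.Modules ℤ}

/-- **Corollary (door form):** if the ε-trace inputs are available for EVERY bounded locally-free presentation `[a, b]` of `K•` (they are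
presentation-independent on paper: `Ext²` and `σ_q` do not see `a, b`), then `K•` is not `gluableSigmaAdmissible` for any `n, I` — the
door `perfectObjClass C gluableSigmaAdmissible` gets no witness from such a complex.  Stated with the door's own `HasDerivedCategory.standard`.
[cite: BuchweitzFlenner2003, §5 (I-semiregular)] -/
theorem not_gluableSigmaAdmissible_of_epsTraceInputs
    (h : ∀ (a b : ℤ) (_ : K.IsStrictlyGE a) (_ : K.IsStrictlyLE b) (hK : ∀ p, IsFiniteLocallyFree (K.X p)) (J : Set ℕ),
      letI := HasDerivedCategory.standard X₀.left.Modules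
      ¬ Summit.Ventures.HSemireg.HomComplex.IsISemiregularC X₀ K a b hK J) :
    ¬ gluableSigmaAdmissible n X₀ I K := by
  rintro ⟨-, -, a, b, _, _, hK, hsr⟩
  exact h a b ‹_› ‹_› hK _ hsr

end PartCDoor

/-! ## Part D — the DIRECT-SUM NO-GO (LEMMA VI) in HYPOTHESIS FORM (g3, gate F4b-LOCAL by pencil; memo
`Cruxes/BlochSeedDiscOne/TorusCarrierTraceNoGo.md` §7e (E.1)–(E.2))

LEMMA VI.  Let the design complex `K•` realise `F = F₁ ⊕ F₂` — it SPLITS because there is no `Ext¹` between the graded pieces of the two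
parts in either direction (for `D_mono`: `dim(Γ_φ ∩ Z_S) ≤ 2` for every bi-graph / coordinate-torus pair, memo §7b (ii), cert
`f4a_design_check.out`) — with TOTAL class `ch₄(F) ∈ ℚh⁴ ⊕ W` (flat) but `ch₄(F₁)` NOT flat.  The inputs, as DISPLAYED BINDERS:
* `split_functorial : P ob = ob₁` — `P` = compression `Ext²(K•,K•) → Ext²(K₁•,K₁•)`, `x ↦ π₁ ∘ x ∘ ι₁`, and `ob`, `ob₁` the obstruction
  classes of `F`, `F₁` along `κ`: INPUT «`At(F₁ ⊕ F₂) = At(F₁) ⊕ At(F₂)`» (naturality of the Atiyah class under split maps);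
* `bf_summand : τ ob₁ = v` with `summand_not_flat : v ≠ 0` — `τ = σ₃` of the summand (`Ext²(K₁•,K₁•) → H⁵(Ω³)`): INPUT [BF03, Cor. 4.3]
  for `F₁` (`σ₃(ob_κ F₁) = κ ⌟ ch₄(F₁)`) and memo §7e (E.2): a rational `(4,4)`-class on `E_i⁸` killed by all 16 `κ⁺_{fg}` is
  `SU(4,4)`-invariant, i.e. flat, while the bi-graph part of `D_mono` has Gram diagonal `g_k = 32(r₊+r₋)(k!(4−k)!)² e_k(λ²)`,
  constant in `k` iff the `λ_j²` are the four (irrational) roots of `t⁴ − 16t³ + 36t² − 16t + 1` — so for rational `λ` some `κ⁺`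
  has `v = κ⁺ ⌟ ch₄(F_bi) ≠ 0`;
* `bf_total : ∀ q, σ_q ob = 0` — [BF03, Cor. 4.3] for `F` and flatness of the TOTAL class (`κ⁺` is a Hodge direction of `ch F`).
CONCLUSION (kernel): `ob ≠ 0` lies in `⋂_q ker σ_q`, so `K•` is not `J`-semiregular for any `J` (and, by `not_gluableSigmaAdmissible_of_…`
as in Part C, never `gluableSigmaAdmissible`); equivalently `F` is first-order OBSTRUCTED along that `κ⁺` although its class stays Hodge.
Nothing is asserted about a concrete complex; HC / HC_CM / HC_AV untouched. -/

section PartD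

/-- **Abstract compression lemma** (the logical core of Lemma VI): if a compression `P ob` of the obstruction class is detected by an
additive map (`τ (P ob) = v ≠ 0`), then `ob ≠ 0`. [folklore] -/
theorem ne_zero_of_compression {M M₁ V : Type*} [AddCommGroup M] [AddCommGroup M₁] [AddCommGroup V]
    (P : M →+ M₁) (τ : M₁ →+ V) {ob : M} {ob₁ : M₁} (split_functorial : P ob = ob₁) {v : V}
    (bf_summand : τ ob₁ = v) (summand_not_flat : v ≠ 0) : ob ≠ 0 := by
  rintro rfl
  apply summand_not_flat
  rw [← bf_summand, ← split_functorial, map_zero, map_zero]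

/-- Instance check for memo §7e (E.2) / §7b: the Gram diagonal of the bi-graph part of `D_mono(λ = (1,2,3,5); r₊ = 2, r₋ = 1)` has
`g₀ = 32·3·(0!4!)²·e₀ = 55 296 ≠ 134 784 = 32·3·(1!3!)²·e₁(1,4,9,25) = g₁` (cert `f4a_design_check.out`: 55296, 134784, 612864,
4358016, 49766400), so `ch₄(F_bi)` is not flat on its own. [folklore] -/
example : 32 * 3 * (Nat.factorial 0 * Nat.factorial 4) ^ 2 * 1 = 55296 ∧
    32 * 3 * (Nat.factorial 1 * Nat.factorial 3) ^ 2 * (1 + 4 + 9 + 25) = 134784 ∧ (55296 : ℕ) ≠ 134784 := by decide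

universe w₂

variable (X₀ : SchemeOver ℂ) [HasDerivedCategory.{w₂} X₀.left.Modules] (K : CochainComplex X₀.left.Modules ℤ)

/-- **LEMMA VI — DIRECT-SUM NO-GO, hypothesis form** (memo §7e (E.1); inputs displayed, see the Part D header): the obstruction class
`ob = ob_κ(F₁ ⊕ F₂)` compresses to `ob₁ = ob_κ(F₁)` (`split_functorial`), which `σ₃` detects (`bf_summand`, `summand_not_flat`:
`κ ⌟ ch₄(F₁) ≠ 0`), so `ob ≠ 0`; and `ob ∈ ⋂_q ker σ_q` (`bf_total`: the total class is flat).  Hence `K•` is not `J`-semiregular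
for any `J`. [cite: BuchweitzFlenner2003, Cor. 4.3, Def. 4.1 and §5 (I-semiregular)] -/
theorem not_isISemiregularC_of_directSumInputs (a b : ℤ) [K.IsStrictlyGE a] [K.IsStrictlyLE b]
    (hK : ∀ p, IsFiniteLocallyFree (K.X p))
    {M₁ V : Type*} [AddCommGroup M₁] [AddCommGroup V]
    (P : ShiftedHom (DerivedCategory.Q.obj K) (DerivedCategory.Q.obj K) (2 : ℤ) →+ M₁)
    (ob : ShiftedHom (DerivedCategory.Q.obj K) (DerivedCategory.Q.obj K) (2 : ℤ)) (ob₁ : M₁)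
    (split_functorial : P ob = ob₁)
    (τ : M₁ →+ V) {v : V} (bf_summand : τ ob₁ = v) (summand_not_flat : v ≠ 0)
    (bf_total : ∀ q : ℕ, Summit.Ventures.HSemireg.HomComplex.sigmaC X₀ K a b hK q ob = 0)
    (J : Set ℕ) : ¬ Summit.Ventures.HSemireg.HomComplex.IsISemiregularC X₀ K a b hK J := by
  intro hJ
  have hne := ne_zero_of_compression P τ split_functorial bf_summand summand_not_flat
  exact hne ((Summit.Ventures.HSemireg.HomComplex.isISemiregularC_iff_ker X₀ K a b hK J).1 hJ _ fun q _ => bf_total q)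

end PartD

/-! ## Part E — THEOREM VII-u (uniform origin no-go for connected edge intersections) — the LINEAR-ALGEBRA CORE, kernel form
(g4, gates N1-c / N1′; memo `Cruxes/BlochSeedDiscOne/TorusCarrierTraceNoGo.md` §7i (I.3))

Setting (memo §7f (F.1)–(F.3), §7i (I.3)): a bi-graph block with carriers `A` (index type `ιA`) and `B` (`ιB`), multiplicity spaces
`U_A`, `V_B`, gluings `e_{BA} : V_B → U_A` (here `e a b`, with the nonzero weights `x_A x′_B` ABSORBED), first-order smoothings
`y^κ_{AB} : U_A → V_B` (here `y a b`) for ONE symmetric Weil direction `κ`.  DISPLAYED BINDERS and what they encode: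
* `hEYoff`, `hYEoff` — (d3) for G = 1 («origin equations = block-diagonality of `𝐄𝐘^κ` and `𝐘^κ𝐄`», memo (F.3); inputs S9);
* `hEYdiag : Σ_B e∘y = α_A • id`, `hYEdiag : Σ_A y∘e = β_B • id` — (d1) COMBINED WITH THE VERTEX IDENTITIES (V_A), (V_B) of memo (I.3)
  STEP 1–2 (inputs S5, S10): the diagonal blocks are the scalars `α_A = x_A φ^κ_A`, `β_B = x′_B ψ^κ_B`.
CONCLUSIONS (kernel): `spectral_matching` — `(α_A − β_B) • e_{BA} = 0` on every edge (STEP 3); `false_of_starved` — if `α ≡ 0`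
(direction κ₁ or κ₂: the A-private classes vanish) and `β_B ≠ 0` for a carrier with `V_B ≠ 0`, contradiction (STEP 4); and the scalar
STEP 5 `triple_eq_zero_of_norm_ne_one` — `v₁ = w₂ = 0` forces the B-vertex triple to vanish unless `c c̄ = 1`.  Chaining them per block
type is memo (I.3); the model inputs S5/S9/S10 stay DISPLAYED (pencil), exactly as for Lemma VI / VII.  Nothing is asserted about a
concrete sheaf; HC / HC_CM / HC_AV untouched; `BlochSeedDiscOne` untouched. -/

section PartE

variable {𝕜 : Type*} [Field 𝕜] {ιA ιB : Type*} [Fintype ιA] [Fintype ιB]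
  {U : ιA → Type*} {V : ιB → Type*} [∀ a, AddCommGroup (U a)] [∀ a, Module 𝕜 (U a)]
  [∀ b, AddCommGroup (V b)] [∀ b, Module 𝕜 (V b)]
  (e : ∀ a b, V b →ₗ[𝕜] U a) (y : ∀ a b, U a →ₗ[𝕜] V b) (α : ιA → 𝕜) (β : ιB → 𝕜)

/-- **Spectral matching** (memo §7i (I.3) STEP 3): if `𝐄𝐘` and `𝐘𝐄` are block-diagonal with SCALAR diagonal blocks `α_A`, `β_B`,
then `(α_A − β_B)·e_{BA} = 0` on every edge — compute `(𝐄𝐘𝐄)_{AB}` in the two bracketings. [folklore] -/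
theorem spectral_matching
    (hEYdiag : ∀ a, ∑ b, (e a b).comp (y a b) = α a • LinearMap.id)
    (hEYoff : ∀ a a', a ≠ a' → ∑ b, (e a b).comp (y a' b) = 0)
    (hYEdiag : ∀ b, ∑ a, (y a b).comp (e a b) = β b • LinearMap.id)
    (hYEoff : ∀ b b', b ≠ b' → ∑ a, (y a b).comp (e a b') = 0)
    (a : ιA) (b : ιB) : (α a - β b) • e a b = 0 := by
  ext v
  simp only [LinearMap.smul_apply, LinearMap.zero_apply]
  rw [sub_smul, sub_eq_zero]
  have h1 : ∑ a', ∑ b', e a b' (y a' b' (e a' b v)) = α a • e a b v := by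
    rw [Finset.sum_eq_single a]
    · have := congrArg (fun f => f (e a b v)) (hEYdiag a)
      simpa [LinearMap.sum_apply] using this
    · intro a' _ ha'
      have := congrArg (fun f => f (e a' b v)) (hEYoff a a' (Ne.symm ha'))
      simpa [LinearMap.sum_apply] using this
    · intro h; exact absurd (Finset.mem_univ a) h
  have h2 : ∑ a', ∑ b', e a b' (y a' b' (e a' b v)) = β b • e a b v := by
    rw [Finset.sum_comm, Finset.sum_eq_single b]
    · have := congrArg (fun f => e a b (f v)) (hYEdiag b)
      simpa [LinearMap.sum_apply, map_sum] using this
    · intro b' _ hb'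
      have := congrArg (fun f => e a b' (f v)) (hYEoff b' b hb')
      simpa [LinearMap.sum_apply, map_sum] using this
    · intro h; exact absurd (Finset.mem_univ b) h
  rw [← h1]; exact h2

/-- **Starvation** (memo §7i (I.3) STEP 4): in a direction with `α ≡ 0` (κ₁, κ₂: the A-private classes `R^κ_A` vanish), a carrier
`B` with `V_B ≠ 0` and `β_B ≠ 0` is impossible — spectral matching kills every `e_{BA}`, and then `Σ_A y∘e = 0 ≠ β_B • id`. [folklore] -/
theorem false_of_starved
    (hEYdiag : ∀ a, ∑ b, (e a b).comp (y a b) = α a • LinearMap.id)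
    (hEYoff : ∀ a a', a ≠ a' → ∑ b, (e a b).comp (y a' b) = 0)
    (hYEdiag : ∀ b, ∑ a, (y a b).comp (e a b) = β b • LinearMap.id)
    (hYEoff : ∀ b b', b ≠ b' → ∑ a, (y a b).comp (e a b') = 0)
    (hα : ∀ a, α a = 0) (b : ιB) [Nontrivial (V b)] (hβ : β b ≠ 0) : False := by
  have he : ∀ a, e a b = 0 := fun a => by
    have h := spectral_matching e y α β hEYdiag hEYoff hYEdiag hYEoff a b
    rw [hα, zero_sub, neg_smul, neg_eq_zero] at h
    exact (smul_eq_zero.mp h).resolve_left hβ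
  have h := hYEdiag b
  simp only [he, LinearMap.comp_zero, Finset.sum_const_zero] at h
  obtain ⟨v, hv⟩ := exists_ne (0 : V b)
  have h0 : (β b • (LinearMap.id : V b →ₗ[𝕜] V b)) v = 0 := by rw [← h]; rfl
  simp only [LinearMap.smul_apply, LinearMap.id_apply, smul_eq_zero] at h0
  rcases h0 with h0 | h0
  · exact hβ h0
  · exact hv h0

/-- **STEP 5 of VII-u** (memo §7i (I.3)): `v₁ = b̂⁰⁰ − c̄ b̂¹¹ = 0` and `w₂ = b̂¹¹ − c b̂⁰⁰ = 0` force `b̂¹¹ = b̂⁰⁰ = 0` unless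
`c c̄ = 1`; with the B-vertex relation `m b̂ⁱⁱ = m b̂⁰⁰/cov + c̄ b̂¹¹/(m cov)` the whole triple then vanishes — so for `|c| ≠ 1`
some κ ∈ {κ₁, κ₂} has `β_B ≠ 0` and `false_of_starved` applies. [folklore] -/
theorem triple_eq_zero_of_norm_ne_one {K : Type*} [Field K] {c cb b00 b11 bii m cov : K}
    (hv₁ : b00 = cb * b11) (hw₂ : b11 = c * b00) (hc : c * cb ≠ 1)
    (hvertex : m * bii = m * b00 / cov + cb * b11 / (m * cov)) (hm : m ≠ 0) :
    b11 = 0 ∧ b00 = 0 ∧ bii = 0 := by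
  have h3 : (1 - c * cb) * b11 = 0 := by
    rw [hv₁] at hw₂; linear_combination hw₂
  have hb11 : b11 = 0 := by
    rcases mul_eq_zero.mp h3 with h | h
    · exact absurd (sub_eq_zero.mp h).symm hc
    · exact h
  have hb00 : b00 = 0 := by rw [hv₁, hb11, mul_zero]
  refine ⟨hb11, hb00, ?_⟩
  have : m * bii = 0 := by rw [hvertex, hb00, hb11]; simp
  exact (mul_eq_zero.mp this).resolve_left hm

end PartE


/-! ## Part F — THEOREM XV (rank-free cycle-trace kill) — the LINEAR-ALGEBRA CORE, kernel form
(g6 THEOREM XV, PREREG P39; g7 typing; memo `Cruxes/BlochSeedDiscOne/sec7m-cycletrace.md` (M.5), uniform version `sec7n-xvu.md` (N.3))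

Setting (memo §7m (M.5)): ONE pinned carrier `P` of a bi-graph block, with multiplicity space `W = U_P` of ANY finite dimension, and
its two vertex operators in a single Weil direction κ — the same-class word `O_S = Σ_B e_{PB} y^κ_{BP}` over the same-class file and the
cross word `O_X` over the cross file; here simply two endomorphisms `OS`, `OX` of `W`.  DISPLAYED BINDERS and what they encode:
* `hS : OS = LS • id`, `hX : OX = LX • id`, `hL : LX * LS ≠ 0` — the CLASS PINS (V) at level κ (STEP 1; inputs (K.1)(P) + (V),
  soft spots S9/S11): on the pinned side the two vertex operators are the non-zero scalars `L_S`, `L_X`;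
* `hword : trace (OX ∘ OS) = 0` — the WORD IDENTITY (XV.2) (STEPS 2–3): expanding `tr(O_X O_S)` over the points of `P`, the B-file
  cross row of `(w,Z)` at `P` and the A-file cross row of `(P,P*)` at `w` are the two pointwise equations at ONE quadruple point `q`
  (QUADRUPLE-POINT LEMMA, g6 ADDENDUM 1 — table fact F2 discharged; uniform in G by XV-u (N.3)), and the weight identity
  `ζ_w ρ_B ρ_A = β_{P,Z} ζ_{P*}` makes the point terms cancel pairwise (the shape of that cancellation is `trace_word_eq_zero_of_weights`).
CONCLUSION (kernel): `finrank W = 0` — the pinned multiplicity space vanishes for every dimension vector («N1′ = KILL at matrix level»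
for the block type, STEP 4: `tr(O_X O_S) = L_X L_S · dim U_P`).  Chaining over block types / levels κ and the verification of the
displayed inputs per type are the memo's (exact certificates ×2, pencil); nothing is asserted about a concrete sheaf; HC / HC_CM / HC_AV
untouched; `BlochSeedDiscOne` untouched. -/

section PartF

/-- **STEP 3 shape** (memo §7m (M.5)): a word trace expanded as a sum of point terms `t_q` with coefficient `c_q − d_q`, where the
weight identity gives `c_q = d_q` at every point, vanishes. [bookkeeping] -/
theorem trace_word_eq_zero_of_weights {𝕜 ι : Type*} [CommRing 𝕜] [Fintype ι] (t c d : ι → 𝕜) (tr : 𝕜)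
    (htr : tr = ∑ q, (c q - d q) * t q) (hweights : ∀ q, c q = d q) : tr = 0 := by
  rw [htr]
  exact Finset.sum_eq_zero (fun q _ => by rw [hweights q, sub_self, zero_mul])

/-- **THEOREM XV, linear-algebra core** (memo §7m (M.5) STEPS 1 + 4): if the two pinned vertex operators are scalars `L_S`, `L_X`
with `L_X L_S ≠ 0` (class pins (V)) and the cycle-trace word identity `tr(O_X ∘ O_S) = 0` holds, then the pinned multiplicity space
is zero-dimensional — for ANY finite dimension, i.e. the kill is rank-free. [folklore] -/
theorem finrank_eq_zero_of_pins_and_word {𝕜 : Type*} [Field 𝕜] [CharZero 𝕜] {W : Type*} [AddCommGroup W] [Module 𝕜 W]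
    [FiniteDimensional 𝕜 W] (OS OX : W →ₗ[𝕜] W) (LS LX : 𝕜)
    (hS : OS = LS • LinearMap.id) (hX : OX = LX • LinearMap.id)
    (hword : LinearMap.trace 𝕜 W (OX ∘ₗ OS) = 0) (hL : LX * LS ≠ 0) : Module.finrank 𝕜 W = 0 := by
  subst hS hX
  have h : ((LX • LinearMap.id) ∘ₗ (LS • LinearMap.id) : W →ₗ[𝕜] W) = (LX * LS) • LinearMap.id := by
    ext w
    simp [smul_smul]
  rw [h, map_smul, LinearMap.trace_id, smul_eq_mul] at hword
  exact_mod_cast (mul_eq_zero.mp hword).resolve_left hL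

/-- The same conclusion read as «`U_P` is the zero space». [folklore] -/
theorem subsingleton_of_pins_and_word {𝕜 : Type*} [Field 𝕜] [CharZero 𝕜] {W : Type*} [AddCommGroup W] [Module 𝕜 W]
    [FiniteDimensional 𝕜 W] (OS OX : W →ₗ[𝕜] W) (LS LX : 𝕜)
    (hS : OS = LS • LinearMap.id) (hX : OX = LX • LinearMap.id)
    (hword : LinearMap.trace 𝕜 W (OX ∘ₗ OS) = 0) (hL : LX * LS ≠ 0) : Subsingleton W :=
  Module.finrank_zero_iff.mp (finrank_eq_zero_of_pins_and_word OS OX LS LX hS hX hword hL)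

end PartF

end Summit.HodgeConjecture.HodgeConjecture.Cruxes.BlochSeedDiscOne.TorusSheafDoor
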